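import Mathlib
import Summits.Ventures.PercRepro2.PMK5KernelY
import Summits.Ventures.PercRepro2.PMK5Strict
import Summits.Ventures.PercRepro2.PMK5Locus

/-!
# THE EQUALITY LOCUS OF THE `Y`-SLACKS (THE `a₃ = b` COINCIDENCE VALUE) ON FIVE-VERTEX BASES — THE POSITIVE SIDE
(blind cell PercRepro2, mine-2 g24; for Theorem 20, the equality locus of (HCOV) on the six-vertex family
`K₅ + a₃ pendant at b`; on `PMK5KernelY.lean` (`certY`, `y_eq_bern`) and `PMK5Locus.lean` (`cfgAvoid2`,
`bern_pos_of_face`))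

`K₅` on the marks `o = 0, a₁ = 1, a₂ = 2, u = 3, b = 4`; an edge set `S` is a bitmask `m < 1024`.  The sum
`Y = Y_L + Y_H` of the two `Y`-slacks of p1's pendant-at-`b` Bernstein identity (`Y_L = bH (oL − A − Dd) − D·Dd`,
`Y_H = bL (oH − B − C) − D·C`; up to the positive multipliers `2bL + D`, `2bH + D` the value of the crux functional
at the `a₃ = b` coincidence) is the Bernstein form `Σ_k bern q k · (cntPosY k − cntNegY k)` with coefficients `≥ 0`.
**The census** (own code, two methods — the class sums by Kronecker digits, and the exact centre values of `Gc` on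
`K₅ + {b, a₃}` at `q = 1` through the pattern law — identical on all 1,024 edge sets): `Y ≡ 0` on the face of `S`
for exactly 744 edge sets, EXACTLY the `Y`-DEGENERATE ones (`RuleY`):
  ¬[o ~ a₁ avoiding {a₂, b}] ∨ ¬[o ~ a₂ avoiding {a₁, b}] ∨ ¬[o ~ b avoiding {a₁, a₂}]
— `o` is cut off from one of `a₁, a₂, b` by the other two (each clause 384 edge sets; symmetric in `a₁, a₂, b`).
Class sums: 37,056 positive profiles of `4^10`, 0 negative, maximum 280; EIGHT minimal nonzero supports (all of
3–4 edges through `o`); the `A`-degenerate edge sets of `PMK5LocusA.RuleA` (560) lie inside (`PMK5LocusPendantB`).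
**`y_K5_pos_of_face`** (this file): on every non-`Y`-degenerate edge set `Y > 0` at every weight vector interior on it
— 8 witness digits (`digY`, one `decide +kernel`), the covering `coverY` (one `decide +kernel` over the 1,024 masks),
face positivity of the Bernstein basis.  The zero side and the «iff»s are in `PMK5LocusZeroY.lean`.  Standard axioms.
-/

namespace Summit.Ventures.PercRepro2

open Hub CovForm

namespace K5

namespace PM

set_option maxRecDepth 100000 in
/-- The class sums of `Y` at the 8 witness profiles, read off the Kronecker digits of `kPosY − kNegY`. -/
theorem digY : (kPosY - kNegY) / KB ^ 69 % KB = 2 ∧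
    (kPosY - kNegY) / KB ^ 2148 % KB = 6 ∧
    (kPosY - kNegY) / KB ^ 32865 % KB = 6 ∧
    (kPosY - kNegY) / KB ^ 17504 % KB = 2 ∧
    (kPosY - kNegY) / KB ^ 524325 % KB = 6 ∧
    (kPosY - kNegY) / KB ^ 263204 % KB = 3 ∧
    (kPosY - kNegY) / KB ^ 278561 % KB = 3 ∧
    (kPosY - kNegY) / KB ^ 279584 % KB = 4 := by
  decide +kernel

/-- Witness 0: the profile of index `69` (support `{oa1 oa2 ob}`, mask `11`) has the `Y`-class sum `2`. -/
theorem wY0 : cntNegY (decode4 69) < cntPosY (decode4 69) :=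
  digit_lt_of_kron cntPosY cntNegY cntPosY_lt cntNegY_le_cntPosY kPosY_eq kNegY_eq 69
    (by norm_num) digY.1 (by norm_num)
/-- Witness 1: the profile of index `2148` (support `{oa2 ou ob a1u}`, mask `46`) has the `Y`-class sum `6`. -/
theorem wY1 : cntNegY (decode4 2148) < cntPosY (decode4 2148) :=
  digit_lt_of_kron cntPosY cntNegY cntPosY_lt cntNegY_le_cntPosY kPosY_eq kNegY_eq 2148
    (by norm_num) digY.2.1 (by norm_num)
/-- Witness 2: the profile of index `32865` (support `{oa1 ou ob a2u}`, mask `141`) has the `Y`-class sum `6`. -/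
theorem wY2 : cntNegY (decode4 32865) < cntPosY (decode4 32865) :=
  digit_lt_of_kron cntPosY cntNegY cntPosY_lt cntNegY_le_cntPosY kPosY_eq kNegY_eq 32865
    (by norm_num) digY.2.2.1 (by norm_num)
/-- Witness 3: the profile of index `17504` (support `{ou ob a1u a2u}`, mask `172`) has the `Y`-class sum `2`. -/
theorem wY3 : cntNegY (decode4 17504) < cntPosY (decode4 17504) :=
  digit_lt_of_kron cntPosY cntNegY cntPosY_lt cntNegY_le_cntPosY kPosY_eq kNegY_eq 17504
    (by norm_num) digY.2.2.2.1 (by norm_num)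
/-- Witness 4: the profile of index `524325` (support `{oa1 oa2 ou ub}`, mask `519`) has the `Y`-class sum `6`. -/
theorem wY4 : cntNegY (decode4 524325) < cntPosY (decode4 524325) :=
  digit_lt_of_kron cntPosY cntNegY cntPosY_lt cntNegY_le_cntPosY kPosY_eq kNegY_eq 524325
    (by norm_num) digY.2.2.2.2.1 (by norm_num)
/-- Witness 5: the profile of index `263204` (support `{oa2 ou a1u ub}`, mask `550`) has the `Y`-class sum `3`. -/
theorem wY5 : cntNegY (decode4 263204) < cntPosY (decode4 263204) :=
  digit_lt_of_kron cntPosY cntNegY cntPosY_lt cntNegY_le_cntPosY kPosY_eq kNegY_eq 263204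
    (by norm_num) digY.2.2.2.2.2.1 (by norm_num)
/-- Witness 6: the profile of index `278561` (support `{oa1 ou a2u ub}`, mask `645`) has the `Y`-class sum `3`. -/
theorem wY6 : cntNegY (decode4 278561) < cntPosY (decode4 278561) :=
  digit_lt_of_kron cntPosY cntNegY cntPosY_lt cntNegY_le_cntPosY kPosY_eq kNegY_eq 278561
    (by norm_num) digY.2.2.2.2.2.2.1 (by norm_num)
/-- Witness 7: the profile of index `279584` (support `{ou a1u a2u ub}`, mask `676`) has the `Y`-class sum `4`. -/
theorem wY7 : cntNegY (decode4 279584) < cntPosY (decode4 279584) :=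
  digit_lt_of_kron cntPosY cntNegY cntPosY_lt cntNegY_le_cntPosY kPosY_eq kNegY_eq 279584
    (by norm_num) digY.2.2.2.2.2.2.2 (by norm_num)

/-- The Kronecker indices of the 8 witness profiles (one per minimal support). -/
def NY : Fin 8 → ℕ := ![69, 2148, 32865, 17504, 524325, 263204, 278561, 279584]

/-- The supports of the 8 witness profiles, as edge bitmasks. -/
def WY : Fin 8 → ℕ := ![11, 46, 141, 172, 519, 550, 645, 676]

/-- Every witness coefficient of `Y` is strictly positive. -/
theorem witnessY_lt : ∀ i : Fin 8, cntNegY (decode4 (NY i)) < cntPosY (decode4 (NY i)) := by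
  intro i
  fin_cases i
  exacts [wY0, wY1, wY2, wY3, wY4, wY5, wY6, wY7]

set_option maxRecDepth 100000 in
/-- The support of the `i`-th witness profile is the mask `WY i`. -/
theorem supp_WY : ∀ i : Fin 8, ∀ e : Fin 10, decode4 (NY i) e ≠ 0 → (WY i).testBit e = true := by
  decide +kernel

/-- **The `Y`-degenerate edge sets** — the exact zero set of the `Y`-slacks on `K₅`: `o` is cut off from one of
`a₁, a₂, b` by the other two. -/
def RuleY (m : ℕ) : Bool :=
  (!conn (cfgAvoid2 m 2 4) 0 1) ||
  (!conn (cfgAvoid2 m 1 4) 0 2) ||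
  (!conn (cfgAvoid2 m 1 2) 0 4)

set_option maxRecDepth 100000 in
/-- **The covering**: every non-`Y`-degenerate edge set contains the support of a witness profile. -/
theorem coverY : ∀ m : Fin 1024, RuleY m = false →
    ∃ i : Fin 8, ∀ e : Fin 10, (WY i).testBit e = true → (m : ℕ).testBit e = true := by
  decide +kernel

section Face

variable {R : Type*} [Field R] [LinearOrder R] [IsStrictOrderedRing R]

/-- **THE EQUALITY LOCUS OF THE `Y`-SLACKS — THE POSITIVE SIDE (Bernstein form).**  On every edge set `m` of `K₅`
that is not `Y`-degenerate, `Σ_k bern q k · (cntPosY k − cntNegY k)` is STRICTLY positive at every weight vector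
`q` interior on `m`. -/
theorem y_K5_pos_of_face (m : ℕ) (hm : m < 1024) (hr : RuleY m = false) (q : Fin 10 → R)
    (hq₁ : ∀ e : Fin 10, m.testBit e = true → 0 < q e ∧ q e < 1)
    (hq₀ : ∀ e : Fin 10, m.testBit e = false → q e = 0) :
    0 < ∑ k, bern q k * ((cntPosY k : ℕ) - (cntNegY k : ℕ) : R) := by
  obtain ⟨i, hi⟩ := coverY ⟨m, hm⟩ hr
  have hk := witnessY_lt i
  have hs : ∀ e : Fin 10, decode4 (NY i) e ≠ 0 → m.testBit e = true := fun e he => hi e (supp_WY i e he)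
  have hb : 0 < bern q (decode4 (NY i)) := bern_pos_of_face hq₁ hq₀ _ hs
  have h01 : ∀ e, 0 ≤ q e ∧ q e ≤ 1 := fun e => by
    by_cases he : m.testBit e = true
    · exact ⟨(hq₁ e he).1.le, (hq₁ e he).2.le⟩
    · rw [hq₀ e (by simpa using he)]
      exact ⟨le_rfl, zero_le_one⟩
  calc (0 : R) < bern q (decode4 (NY i)) * ((cntPosY (decode4 (NY i)) : ℕ) - (cntNegY (decode4 (NY i)) : ℕ) : R) := by
        apply mul_pos hb
        rw [sub_pos]
        exact_mod_cast hk
    _ ≤ ∑ k, bern q k * ((cntPosY k : ℕ) - (cntNegY k : ℕ) : R) :=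
        Finset.single_le_sum (f := fun k => bern q k * ((cntPosY k : ℕ) - (cntNegY k : ℕ) : R))
          (fun k _ => mul_nonneg (bern_nonneg h01 k) (by rw [sub_nonneg]; exact_mod_cast cntNegY_le_cntPosY k))
          (Finset.mem_univ _)

end Face

end PM

end K5

end Summit.Ventures.PercRepro2
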